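import Summits.KontsevichZagierPeriods.KontsevichZagierPeriods.Theorems.LinRedNormalFormArrangementNormalFormStubSeparateZeroPoles
import Literature.NumberTheory.Transcendental.KZCalculus
import Literature.NumberTheory.Transcendental.KZGroundingRelations
import Literature.NumberTheory.Transcendental.KZLogCalculusProofs
import Literature.NumberTheory.Transcendental.KZSemiCanonicalReductionProofs
import Literature.NumberTheory.Transcendental.KZDominatedFamilyRelations
import Literature.NumberTheory.Transcendental.SemialgebraicMapsProofs

/-!
# Stub `stub_separateZero` (crux `ArrangementNormalForm`, line `janus-bands`) — part `PartialFractions`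

PARTIAL FRACTIONS OVER `ℚ` with constant coefficients (`pf_exists`, pure algebra: split
`1/((y−λ)(y−μ))` while two distinct poles are active, then Taylor-expand the numerator at the last
pole; the terms `q (y − μ)^{n₁}/(y − μ)^{n₂}` have `n₁ = 0 ∨ n₂ = 0` and polar order at most
`E μ − ρ_μ`), the dictionary with the literal `JJ`/`GG` texts, semialgebraicity of quotients with
vanishing denominators, and TERMWISE ABSOLUTE CONVERGENCE (`integrableOn_tev_mul_LB`).
-/

noncomputable section

open Set MeasureTheory Polynomial
open Literature.NumberTheory.Transcendental
open Literature.ModelTheory.ExponentialFields (IsSemialgebraic isSemialgebraic_setOf_eval_eq_zero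
  isSemialgebraic_setOf_eval_ne_zero)
open scoped ENNReal

namespace Summit.KontsevichZagierPeriods.ArrangementNormalForm.JanusBands

namespace SepZero

variable {m : ℕ}

/-- A term `(q, μ, n₁, n₂)` evaluates to `q (y − μ)^{n₁} / (y − μ)^{n₂}`. -/
def tev (T : ℚ × ℚ × ℕ × ℕ) (y : ℝ) : ℝ :=
  (T.1 : ℝ) * ((y - T.2.1) ^ T.2.2.1 / (y - T.2.1) ^ T.2.2.2)

/-- Admissible terms: the `GG` shape condition `n₁ = 0 ∨ n₂ = 0`, and polar terms with nonzero
coefficient have order at most `E μ − ρ_μ`. -/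
def TermOK (P : ℚ[X]) (L : Fin m → Atom) (e : Fin m → ℕ) (T : ℚ × ℚ × ℕ × ℕ) : Prop :=
  (T.2.2.1 = 0 ∨ T.2.2.2 = 0) ∧
    (T.1 = 0 ∨ T.2.2.2 = 0 ∨ T.2.2.2 + P.rootMultiplicity T.2.1 ≤ Emul L e T.2.1)

/-- Lowering one multiplicity multiplies the product of inverse letters by the letter. -/
theorem prod_pow_update {ι : Type*} [Fintype ι] [DecidableEq ι] (u : ι → ℝ) (d : ι → ℕ) (i : ι)
    (hd : d i ≠ 0) : ∏ l, u l ^ d l = (∏ l, u l ^ Function.update d i (d i - 1) l) * u i := by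
  rw [← Finset.mul_prod_erase _ _ (Finset.mem_univ i), ← Finset.mul_prod_erase _ _ (Finset.mem_univ i),
    Function.update_self]
  have : ∏ l ∈ Finset.univ.erase i, u l ^ Function.update d i (d i - 1) l =
      ∏ l ∈ Finset.univ.erase i, u l ^ d l :=
    Finset.prod_congr rfl fun l hl => by rw [Function.update_of_ne (Finset.ne_of_mem_erase hl)]
  rw [this]
  obtain ⟨n, hn⟩ := Nat.exists_eq_succ_of_ne_zero hd
  rw [hn, Nat.succ_sub_one, pow_succ]
  ring

/-- Taylor expansion of the numerator at `μ`, evaluated in `ℝ`. -/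
theorem aeval_eq_sum_taylor (P : ℚ[X]) (μ : ℚ) (y : ℝ) :
    Polynomial.aeval y P = ∑ i ∈ Finset.range (P.natDegree + 1),
      ((taylor μ P).coeff i : ℝ) * (y - μ) ^ i := by
  have h1 : Polynomial.aeval y P = Polynomial.aeval (y - μ) (taylor μ P) := by
    rw [taylor_apply, aeval_comp]
    simp
  rw [h1, aeval_eq_sum_range, natDegree_taylor]
  refine Finset.sum_congr rfl fun i _ => ?_
  rw [Algebra.smul_def]; rfl

/-- Taylor coefficients below the order of vanishing are zero. -/
theorem taylor_coeff_eq_zero (P : ℚ[X]) (μ : ℚ) {i : ℕ} (hi : i < P.rootMultiplicity μ) :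
    (taylor μ P).coeff i = 0 := by
  rw [rootMultiplicity_eq_natTrailingDegree, ← taylor_apply] at hi
  exact coeff_eq_zero_of_lt_natTrailingDegree hi

/-- Terminal case of the partial fraction recursion: all active rows have the same root `r₀`
(Taylor expansion of the numerator at `r₀`). -/
theorem pf_terminal (P : ℚ[X]) (L : Fin m → Atom) (e : Fin m → ℕ) (d : Fin m → ℕ) (κ : ℚ) (N : ℕ)
    (hN : ∑ j, d j = N) (hd : ∀ j, d j ≤ dz L e j) {r₀ : ℚ}
    (hr₀ : ∀ j, d j ≠ 0 → root (L j) = r₀) :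
    ∃ (n : ℕ) (T : Fin n → ℚ × ℚ × ℕ × ℕ), (∀ l, TermOK P L e (T l)) ∧
      ∀ y : ℝ, (∀ j, d j ≠ 0 → y ≠ root (L j)) →
        (κ : ℝ) * Polynomial.aeval y P * ∏ j, (1 / (y - root (L j))) ^ d j =
          ∑ l, tev (T l) y := by
  classical
  set tc : ℕ → ℚ := fun i => (taylor r₀ P).coeff i with htc
  refine ⟨P.natDegree + 1, fun i => (κ * tc i, r₀, (i : ℕ) - N, N - i), fun i => ⟨?_, ?_⟩,
    fun y hy => ?_⟩
  · simp only; omega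
  · simp only
    by_cases h0 : tc i = 0
    · left; rw [h0, mul_zero]
    by_cases hNi : N ≤ i
    · right; left; omega
    right; right
    have hρ : P.rootMultiplicity r₀ ≤ i := by
      by_contra h; push Not at h
      exact h0 (taylor_coeff_eq_zero P r₀ h)
    have hNE : N ≤ Emul L e r₀ := by
      rw [← hN, Emul]
      have : ∑ j, d j = ∑ j ∈ Finset.univ.filter (fun j => root (L j) = r₀), d j := by
        rw [Finset.sum_filter]
        refine Finset.sum_congr rfl fun j _ => ?_
        by_cases hj : d j = 0
        · simp [hj]
        · rw [if_pos (hr₀ j hj)]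
      rw [this]
      exact Finset.sum_le_sum fun j _ => hd j
    omega
  · -- the identity
    have hprod : ∏ j, (1 / (y - root (L j))) ^ d j = (1 / (y - r₀)) ^ N := by
      rw [← hN, ← Finset.prod_pow_eq_pow_sum]
      refine Finset.prod_congr rfl fun j _ => ?_
      by_cases hj : d j = 0
      · simp [hj]
      · rw [hr₀ j hj]
    rw [hprod, aeval_eq_sum_taylor P r₀ y, Finset.mul_sum, Finset.sum_mul, Fin.sum_univ_eq_sum_range
      (fun i => tev (κ * tc i, r₀, i - N, N - i) y) (P.natDegree + 1)]
    refine Finset.sum_congr rfl fun i hi => ?_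
    simp only [tev, htc]
    push_cast
    have key : (y - r₀) ^ i * (1 / (y - r₀)) ^ N = (y - r₀) ^ (i - N) / (y - r₀) ^ (N - i) := by
      rcases Nat.eq_zero_or_pos N with hN0 | hNpos
      · simp [hN0]
      · -- some row is active, so y ≠ r₀
        have hyr : y - r₀ ≠ 0 := by
          obtain ⟨j, hj⟩ : ∃ j, d j ≠ 0 := by
            by_contra h; push Not at h
            rw [Finset.sum_eq_zero (fun j _ => h j)] at hN; omega
          rw [← hr₀ j hj]; exact sub_ne_zero.2 (hy j hj)
        have h1 : (y - r₀) ^ i * (1 / (y - r₀)) ^ N = (y - r₀) ^ i / (y - r₀) ^ N := by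
          rw [one_div, inv_pow, div_eq_mul_inv]
        rw [h1]
        rcases le_or_gt N i with hle | hlt
        · rw [Nat.sub_eq_zero_of_le hle, pow_zero, div_one, pow_sub₀ _ hyr hle, div_eq_mul_inv]
        · rw [Nat.sub_eq_zero_of_le hlt.le, pow_zero, pow_sub₀ _ hyr hlt.le]
          field_simp
    rw [← key]; ring

/-- **Partial fractions over `ℚ` with constant coefficients.** For every multiplicity vector
`d ≤ dz` and constant `κ` there are finitely many admissible terms whose sum is
`κ P(y) ∏ⱼ (y − rootⱼ)^{-dⱼ}` off the active poles. -/
theorem pf_exists (P : ℚ[X]) (L : Fin m → Atom) (e : Fin m → ℕ) :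
    ∀ (N : ℕ) (d : Fin m → ℕ) (κ : ℚ), ∑ j, d j = N → (∀ j, d j ≤ dz L e j) →
    ∃ (n : ℕ) (T : Fin n → ℚ × ℚ × ℕ × ℕ), (∀ l, TermOK P L e (T l)) ∧
      ∀ y : ℝ, (∀ j, d j ≠ 0 → y ≠ root (L j)) →
        (κ : ℝ) * Polynomial.aeval y P * ∏ j, (1 / (y - root (L j))) ^ d j = ∑ l, tev (T l) y := by
  classical
  intro N
  induction N with
  | zero =>
    intro d κ hN hd
    exact pf_terminal P L e d κ 0 hN hd (r₀ := 0) fun j hj =>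
      absurd (Finset.sum_eq_zero_iff.1 hN j (Finset.mem_univ j)) hj
  | succ N ih =>
    intro d κ hN hd
    by_cases hsplit : ∃ j j', d j ≠ 0 ∧ d j' ≠ 0 ∧ root (L j) ≠ root (L j')
    · obtain ⟨j, j', hj, hj', hne⟩ := hsplit
      have hjj' : j ≠ j' := fun h => hne (by rw [h])
      set d₁ := Function.update d j' (d j' - 1) with hd₁
      set d₂ := Function.update d j (d j - 1) with hd₂
      have hsum : ∀ i : Fin m, d i ≠ 0 → ∑ l, Function.update d i (d i - 1) l = N := by
        intro i hi
        rw [Finset.sum_update_of_mem (Finset.mem_univ _)]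
        have h1 := Finset.sum_eq_add_sum_sdiff_singleton_of_mem (Finset.mem_univ i) d
        omega
      have hle : ∀ (i : Fin m) l, Function.update d i (d i - 1) l ≤ dz L e l := by
        intro i l
        by_cases h : l = i
        · subst h; simp only [Function.update_self]; exact le_trans (Nat.sub_le _ _) (hd l)
        · rw [Function.update_of_ne h]; exact hd l
      obtain ⟨n₁, T₁, hT₁, hid₁⟩ := ih d₁ (κ / (root (L j) - root (L j'))) (hsum j' hj') (hle j')
      obtain ⟨n₂, T₂, hT₂, hid₂⟩ := ih d₂ (-(κ / (root (L j) - root (L j')))) (hsum j hj) (hle j)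
      refine ⟨n₁ + n₂, Fin.append T₁ T₂, fun l => ?_, fun y hy => ?_⟩
      · refine Fin.addCases (fun l => ?_) (fun l => ?_) l
        · simpa using hT₁ l
        · simpa using hT₂ l
      · have hact : ∀ (i : Fin m) l, Function.update d i (d i - 1) l ≠ 0 → d l ≠ 0 := by
          intro i l h
          by_cases h' : l = i
          · subst h'; simp only [Function.update_self] at h; omega
          · rwa [Function.update_of_ne h'] at h
        have hy₁ := hid₁ y fun l hl => hy l (hact j' l hl)
        have hy₂ := hid₂ y fun l hl => hy l (hact j l hl)
        rw [Fin.sum_univ_add]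
        simp only [Fin.append_left, Fin.append_right]
        rw [← hy₁, ← hy₂]
        set u : Fin m → ℝ := fun l => 1 / (y - root (L l)) with hu
        have huj : y - root (L j) ≠ 0 := sub_ne_zero.2 (hy j hj)
        have huj' : y - root (L j') ≠ 0 := sub_ne_zero.2 (hy j' hj')
        have hrr : (root (L j) : ℝ) - root (L j') ≠ 0 := by
          rw [sub_ne_zero]; exact_mod_cast hne
        set A := ∏ l, u l ^ Function.update d₁ j (d₁ j - 1) l with hA
        have hd₁j : d₁ j = d j := by rw [hd₁, Function.update_of_ne hjj']
        have h1 : ∏ l, u l ^ d l = (∏ l, u l ^ d₁ l) * u j' := prod_pow_update u d j' hj'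
        have h2 : ∏ l, u l ^ d₁ l = A * u j := by
          rw [hA]; exact prod_pow_update u d₁ j (by rw [hd₁j]; exact hj)
        have hd₂j' : d₂ j' = d j' := by rw [hd₂, Function.update_of_ne (Ne.symm hjj')]
        have h12 : Function.update d₂ j' (d₂ j' - 1) = Function.update d₁ j (d₁ j - 1) := by
          rw [hd₂j', hd₁j, hd₂, hd₁, Function.update_comm hjj']
        have h3 : ∏ l, u l ^ d₂ l = A * u j' := by
          rw [prod_pow_update u d₂ j' (by rw [hd₂j']; exact hj'), h12]
        change (κ : ℝ) * Polynomial.aeval y P * ∏ l, u l ^ d l =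
          ((κ / (root (L j) - root (L j')) : ℚ) : ℝ) * Polynomial.aeval y P * ∏ l, u l ^ d₁ l +
          ((-(κ / (root (L j) - root (L j'))) : ℚ) : ℝ) * Polynomial.aeval y P * ∏ l, u l ^ d₂ l
        rw [h1, h2, h3]
        push_cast
        simp only [hu]
        field_simp
        ring
    · push Not at hsplit
      have hlam : ∃ r₀ : ℚ, ∀ j, d j ≠ 0 → root (L j) = r₀ := by
        by_cases h : ∃ j, d j ≠ 0
        · obtain ⟨j₀, hj₀⟩ := h
          exact ⟨root (L j₀), fun j hj => (hsplit j j₀ hj hj₀)⟩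
        · push Not at h
          exact ⟨0, fun j hj => absurd (h j) hj⟩
      obtain ⟨r₀, hr₀⟩ := hlam
      exact pf_terminal P L e d κ (N + 1) hN hd hr₀

variable {k : ℕ}

/-! ### Dictionary with the literal texts -/

/-- The literal bound text equals `bv`. -/
theorem sumElim_eq_bv (z : Fin (1 + k) → ℝ) (u : Fin k ⊕ Atom) :
    Sum.elim (fun j => z (Fin.natAdd 1 j))
      (fun c : Atom => ∑ i', (c.1 i' : ℝ) * z (Fin.castAdd k i') + (c.2 : ℝ)) u = bv z u := by
  cases u with
  | inl j => rfl
  | inr c => simp [bv, av, bo]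

/-- The literal integrand text equals `R(y) · LB`. -/
theorem literal_integrand_eq (p : MvPolynomial (Fin 1) ℚ) (L : Fin m → Atom) (e : Fin m → ℕ)
    (a : Fin k → Option Atom) (z : Fin (1 + k) → ℝ) :
    MvPolynomial.aeval (fun i => z (Fin.castAdd k i)) p /
      (∏ j, (∑ i, ((L j).1 i : ℝ) * z (Fin.castAdd k i) + ((L j).2 : ℝ)) ^ e j) *
      ∏ i, (a i).elim 1 (fun c => 1 / (z (Fin.natAdd 1 i) -
        (∑ i', (c.1 i' : ℝ) * z (Fin.castAdd k i') + (c.2 : ℝ)))) =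
    Rf (toPoly p) L e (z (bo k)) * LB a z := by
  have h1 : (fun i : Fin 1 => z (Fin.castAdd k i)) = fun _ => z (bo k) := by
    funext i; rw [Fin.fin_one_eq_zero i]; rfl
  rw [Rf, aeval_toPoly, h1]
  simp only [Fin.sum_univ_one, Qf, LB, av]
  rfl

/-- The literal `GG` class text (base dimension `b`, flag `σ`, `k` fibres). -/
def GGlit (b σ k : ℕ) : Set KZ.FormalRep := {w : KZ.FormalRep | ∃ (m m' n₁ n₂ : ℕ) (s : KZ.IntegralRep (b + 1 + k)) (M : Fin m' → (Fin (b + 1) → ℚ) × ℚ) (L : Fin m → (Fin b → ℚ) × ℚ) (e : Fin m → ℕ) (p : MvPolynomial (Fin b) ℚ) (ℓ₁ ℓ₂ : (Fin b → ℚ) × ℚ) (a : Fin k → Option ((Fin (b + 1) → ℚ) × ℚ)) (lo hi : Fin k → Fin k ⊕ ((Fin (b + 1) → ℚ) × ℚ)), (n₁ = 0 ∨ n₂ = 0) ∧ (σ = 2 → (∀ i c, a i = some c → c.1 (Fin.last b) = 0) ∧ (∀ i c, (lo i = Sum.inr c ∨ hi i = Sum.inr c) → (c.1 (Fin.last b)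 = 0 ∨ c = (Pi.single (Fin.last b) 1, 0)))) ∧ Bornology.IsBounded s.domain ∧ s.domain = {z | (∀ j, 0 < ∑ i, ((M j).1 i : ℝ) * z (Fin.castAdd k i) + ((M j).2 : ℝ)) ∧ ∀ i, Sum.elim (fun j => z (Fin.natAdd (b + 1) j)) (fun c => ∑ i', (c.1 i' : ℝ) * z (Fin.castAdd k i') + (c.2 : ℝ)) (lo i) < z (Fin.natAdd (b + 1) i) ∧ z (Fin.natAdd (b + 1) i) < Sum.elim (fun j => z (Fin.natAdd (b + 1) j)) (fun c => ∑ i', (c.1 i' : ℝ) * z (Fin.castAdd k i') + (c.2 : ℝ)) (hi i)} ∧ EqOn s.integrand (fun z => MvPolynomial.aeval (fun i => z (Fin.castAdd k (Fin.castSucc i))) p / (∏ j, (∑ i, ((L j).1 i : ℝ) * z (Fin.castAdd k (Fin.castSucc i)) + ((L j).2 : ℝ)) ^ e j) * ((z (Fin.castAdd k (Fin.last b)) - (∑ i, (ℓ₁.1 i : ℝ) * z (Fin.castAdd k (Fin.castSucc i)) + (ℓ₁.2 : ℝ))) ^ n₁ / (z (Fin.castAdd k (Fin.last b)) - (∑ i,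 (ℓ₂.1 i : ℝ) * z (Fin.castAdd k (Fin.castSucc i)) + (ℓ₂.2 : ℝ))) ^ n₂) * ∏ i, (a i).elim 1 (fun c => 1 / (z (Fin.natAdd (b + 1) i) - (∑ i', (c.1 i' : ℝ) * z (Fin.castAdd k i') + (c.2 : ℝ))))) s.domain ∧ w = KZ.of s}

/-- Membership of a term representation in `GG 0 1 k`. -/
theorem mem_GGlit {m' : ℕ} (M : Fin m' → Atom) (lo hi : Fin k → Fin k ⊕ Atom)
    (a : Fin k → Option Atom) (R : KZ.IntegralRep (1 + k)) (hbd : Bornology.IsBounded R.domain)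
    (hdom : R.domain = {z | (∀ j, 0 < ∑ i, ((M j).1 i : ℝ) * z (Fin.castAdd k i) + ((M j).2 : ℝ)) ∧ ∀ i, Sum.elim (fun j => z (Fin.natAdd 1 j)) (fun c => ∑ i', (c.1 i' : ℝ) * z (Fin.castAdd k i') + (c.2 : ℝ)) (lo i) < z (Fin.natAdd 1 i) ∧ z (Fin.natAdd 1 i) < Sum.elim (fun j => z (Fin.natAdd 1 j)) (fun c => ∑ i', (c.1 i' : ℝ) * z (Fin.castAdd k i') + (c.2 : ℝ)) (hi i)})
    (T : ℚ × ℚ × ℕ × ℕ) (hT : T.2.2.1 = 0 ∨ T.2.2.2 = 0)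
    (hint : ∀ z, R.integrand z = tev T (z (bo k)) * LB a z) :
    KZ.of R ∈ GGlit 0 1 k := by
  refine ⟨0, m', T.2.2.1, T.2.2.2, R, M, Fin.elim0, Fin.elim0, MvPolynomial.C T.1, (Fin.elim0, T.2.1),
    (Fin.elim0, T.2.1), a, lo, hi, hT, fun h => absurd h (by decide), hbd, hdom, fun z _ => ?_, rfl⟩
  rw [hint z]
  simp only [MvPolynomial.aeval_C, eq_ratCast, Finset.univ_eq_empty, Finset.prod_empty,
    Finset.sum_empty, zero_add, div_one, Fin.sum_univ_succ, add_zero, tev, LB, av]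
  rfl

/-! ### Semialgebraicity -/

/-- Quotients of polynomials are semialgebraic functions even where the denominator vanishes
(Lean's `x / 0 = 0`): glue the graph over `{q ≠ 0}` and the zero graph over `{q = 0}`. -/
theorem isSemialgebraicFunOn_div {N : ℕ} {s : Set (Fin N → ℝ)} (hs : IsSemialgebraic ℚ s)
    (p q : MvPolynomial (Fin N) ℚ) :
    IsSemialgebraicFunOn ℚ s (fun x => MvPolynomial.aeval x p / MvPolynomial.aeval x q) := by
  have h1 : IsSemialgebraic ℚ (s ∩ {x | MvPolynomial.aeval x q ≠ 0}) :=
    hs.inter (isSemialgebraic_setOf_eval_ne_zero q)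
  have h2 : IsSemialgebraic ℚ (s ∩ {x | MvPolynomial.aeval x q = 0}) :=
    hs.inter (isSemialgebraic_setOf_eval_eq_zero q)
  have g1 : IsSemialgebraicFunOn ℚ (s ∩ {x | MvPolynomial.aeval x q ≠ 0})
      (fun x => MvPolynomial.aeval x p / MvPolynomial.aeval x q) :=
    isSemialgebraicFunOn_aeval_div_aeval h1 p q fun x hx => hx.2
  have g2 : IsSemialgebraicFunOn ℚ (s ∩ {x | MvPolynomial.aeval x q = 0})
      (fun x => MvPolynomial.aeval x p / MvPolynomial.aeval x q) :=
    (isSemialgebraicFunOn_aeval h2 0).congr fun x hx => by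
      simp only [map_zero, mem_inter_iff, mem_setOf_eq] at hx ⊢; rw [hx.2, div_zero]
  unfold IsSemialgebraicFunOn at g1 g2 ⊢
  convert g1.union g2 using 1
  ext z
  simp only [mem_setOf_eq, mem_union, mem_inter_iff]
  constructor
  · rintro ⟨x, hx, rfl⟩
    by_cases hq : MvPolynomial.aeval x q = 0
    · exact Or.inr ⟨x, ⟨hx, hq⟩, rfl⟩
    · exact Or.inl ⟨x, ⟨hx, hq⟩, rfl⟩
  · rintro (⟨x, hx, rfl⟩ | ⟨x, hx, rfl⟩) <;> exact ⟨x, hx.1, rfl⟩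

/-- A term integrand as one quotient of polynomials (with Lean's conventions at the zeros). -/
theorem tev_mul_LB_eq (T : ℚ × ℚ × ℕ × ℕ) (a : Fin k → Option Atom) (z : Fin (1 + k) → ℝ) :
    tev T (z (bo k)) * LB a z =
      MvPolynomial.aeval z (MvPolynomial.C T.1 * (MvPolynomial.X (bo k) - MvPolynomial.C T.2.1) ^ T.2.2.1) /
      MvPolynomial.aeval z ((MvPolynomial.X (bo k) - MvPolynomial.C T.2.1) ^ T.2.2.2 *
        ∏ i, (a i).elim 1 (fun c => MvPolynomial.X (fc i) -
          (MvPolynomial.C (c.1 0) * MvPolynomial.X (bo k) + MvPolynomial.C c.2))) := by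
  have hfac : ∀ i, (a i).elim (1:ℝ) (fun c => 1 / (z (fc i) - av c (z (bo k)))) =
      (MvPolynomial.aeval z ((a i).elim 1 (fun c => MvPolynomial.X (fc i) -
        (MvPolynomial.C (c.1 0) * MvPolynomial.X (bo k) + MvPolynomial.C c.2))))⁻¹ := by
    intro i; cases a i with
    | none => simp
    | some c => simp [av, one_div]
  simp only [tev, LB, hfac, Finset.prod_inv_distrib, map_mul, map_pow, map_sub, MvPolynomial.aeval_C,
    MvPolynomial.aeval_X, eq_ratCast, map_prod]
  rw [div_eq_mul_inv, div_eq_mul_inv, mul_inv]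
  ring

/-- Term integrands are semialgebraic. -/
theorem isSemialgebraicFunOn_tev_mul_LB {s : Set (Fin (1 + k) → ℝ)} (hs : IsSemialgebraic ℚ s)
    (T : ℚ × ℚ × ℕ × ℕ) (a : Fin k → Option Atom) :
    IsSemialgebraicFunOn ℚ s (fun z => tev T (z (bo k)) * LB a z) :=
  (isSemialgebraicFunOn_div hs _ _).congr fun z _ => (tev_mul_LB_eq T a z).symm

/-- The pole hyperplanes are semialgebraic. -/
theorem isSemialgebraic_Npol (k : ℕ) (L : Fin m → Atom) : IsSemialgebraic ℚ (Npol k L) := by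
  classical
  have : Npol k L = ⋃ j ∈ Finset.univ.filter (fun j => (L j).1 0 ≠ 0),
      {z : Fin (1 + k) → ℝ | MvPolynomial.aeval z (MvPolynomial.X (bo k) - MvPolynomial.C (root (L j))) = 0} := by
    ext z
    simp only [Npol, mem_setOf_eq, mem_iUnion, Finset.mem_filter, Finset.mem_univ, true_and,
      map_sub, MvPolynomial.aeval_X, MvPolynomial.aeval_C, eq_ratCast, sub_eq_zero, exists_prop]
  rw [this]
  exact IsSemialgebraic.biUnion _ _ fun j _ => isSemialgebraic_setOf_eval_eq_zero _

/-! ### Integrability of the terms -/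

/-- A term is measurable in `y`. -/
theorem measurable_tev (T : ℚ × ℚ × ℕ × ℕ) : Measurable (tev T) :=
  measurable_const.mul (((measurable_id.sub_const _).pow_const _).div
    ((measurable_id.sub_const _).pow_const _))

/-- **Termwise absolute convergence.** An admissible term times the letter block is integrable on
the domain: zero coefficient, or polynomial factor (bounded) times `LB`, or a pole of order at most
`E μ − ρ_μ` (domination at the pole). -/
theorem integrableOn_tev_mul_LB {D : Set (Fin (1 + k) → ℝ)} (hDm : MeasurableSet D)
    (a : Fin k → Option Atom) (P : ℚ[X]) (L : Fin m → Atom) (e : Fin m → ℕ) {Lb : ℝ}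
    (hL : ∀ z ∈ D, ∀ j, |z j| ≤ Lb) (hLB : IntegrableOn (LB a) D)
    (hpole : ∀ (μ : ℚ) (n : ℕ), n + min (P.rootMultiplicity μ) (Emul L e μ) ≤ Emul L e μ →
      IntegrableOn (fun z => 1 / (z (bo k) - μ) ^ n * LB a z) D)
    (T : ℚ × ℚ × ℕ × ℕ) (hT : TermOK P L e T) :
    IntegrableOn (fun z => tev T (z (bo k)) * LB a z) D := by
  obtain ⟨q, μ, n₁, n₂⟩ := T
  obtain ⟨h12, hadm⟩ := hT
  simp only at h12 hadm ⊢
  have hmeas : AEStronglyMeasurable (fun z : Fin (1 + k) → ℝ => tev (q, μ, n₁, n₂) (z (bo k)))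
      (volume.restrict D) := ((measurable_tev _).comp (measurable_pi_apply _)).aestronglyMeasurable
  by_cases hn₂ : n₂ = 0
  · -- polynomial factor: bounded
    subst hn₂
    refine hLB.bdd_mul (c := |(q:ℝ)| * (|Lb| + |(μ:ℝ)|) ^ n₁) hmeas ?_
    filter_upwards [ae_restrict_mem hDm] with z hz
    rw [Real.norm_eq_abs, tev]
    simp only [pow_zero, div_one, abs_mul, abs_pow]
    refine mul_le_mul_of_nonneg_left (pow_le_pow_left₀ (abs_nonneg _) ?_ _) (abs_nonneg _)
    exact (abs_sub _ _).trans (add_le_add ((hL z hz _).trans (le_abs_self _)) le_rfl)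
  rcases hadm with hq | hn2 | hle
  · have : (fun z : Fin (1 + k) → ℝ => tev (q, μ, n₁, n₂) (z (bo k)) * LB a z) = fun _ => 0 := by
      funext z; simp [tev, hq]
    rw [this]; exact integrableOn_zero
  · exact absurd hn2 hn₂
  · have hn₁ : n₁ = 0 := h12.resolve_right hn₂
    subst hn₁
    have h : IntegrableOn (fun z : Fin (1 + k) → ℝ => (q : ℝ) * (1 / (z (bo k) - μ) ^ n₂ * LB a z)) D :=
      (hpole μ n₂ (le_trans (Nat.add_le_add_left (min_le_left _ _) n₂) hle)).const_mul (q : ℝ)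
    refine IntegrableOn.congr_fun h (fun z _ => ?_) hDm
    simp only [tev, pow_zero]; ring

end SepZero

/-- Registered support goal of this file: Taylor coefficients below the order of vanishing are zero. -/
theorem separateZero_partialFractions (P : Polynomial ℚ) (μ : ℚ) (i : ℕ) (hi : i < P.rootMultiplicity μ) : (Polynomial.taylor μ P).coeff i = 0 :=
  SepZero.taylor_coeff_eq_zero P μ hi

end Summit.KontsevichZagierPeriods.ArrangementNormalForm.JanusBands
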